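import Summits.QuantumFields.YangMills.Theorems.BalabanUVNodesN07Thm1MixedPlaquetteObstruction
import Summits.QuantumFields.YangMills.Theorems.BalabanUVNodesK0VariationalThm1ScaledCorner

/-!
# K0⁗ ∕ RECORD13 gate ROW P11 — THE DATUM COUPLING, COMPLEMENT of dag-n07-e's mixed-plaquette certificate (`…N07Thm1MixedPlaquetteObstruction`, p504442, the ONE
# DECLARER of `¬ VariationalThm1ScaledSep`, dag-lead DEDUP-256 (A)): (c1) every `SU(N)`, `N ≥ 2`; (c2) the REPAIR CERTIFICATE — print's (7) plaquette of the
# refuting datum is the jump itself, so the re-typed datum clause C′ EXCLUDES the witness; (c3) `Γ₁^{(1)} = {0}`; (c4) C′ costs nothing for data in the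
# image of the averaging (`spliceAt` of an averaged family is the averaged family)

Cell `pub-ymgap`, seat `pub-ymgap-dag-n21-c` (g6), `--supports stmt-QuantumFields-20289 --as helper` (K0⁗ `Record13SepInhabited`, ROW P11 negative side; plan g67
KEY-18 ∕ director-ym №140 ∕ №141).  COUNT-NEUTRAL.  The two seats located the same defect independently (n21-c g6 STARTED∕VERDICT I.16728∕I.16977; n07-e g6
LOCATED-MIXED I.16936, declarer of record by 6 min): print's datum regularity [15] = [Balaban1985Variational] (7) p. 278 — «If p′ intersects the boundary of
Λ_j then some bonds b do not belong to Λ_j and we replace V_b by V̄_b … y, z ∈ Λ_{j−1} and we define (∂V)(p′) = V(x,y)V̄(y,z)V(z,w)V(w,x)» — COUPLES the scales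
(the sticking-out bonds of a scale-`j` plaquette carry the AVERAGES of the finer datum), whereas node00-def-P11's typed facts `VariationalThm1Scaled(Sep)` ∕
`VariationalThm1Class` (`Node00/Record12BgRowAnalysis` :148 ∕ :474 ∕ :159) bound each `W n` ALONE on `plaqsOf (genSet s.Ω k n)`; the constraint `M_𝐁(U) = W`
then admits a flat but cross-scale-INCOMPATIBLE pure-gauge datum whose fibre meets no regularity class, so the facts' EXISTENCE conjunct fails at every `B₃`
(n07-e `not_exists_mem_class_agreeOn`, `not_variationalThm1ScaledSep_of_dist1 (hG : ∃ g : SU N, dist1 g = 1)`, `not_variationalThm1ScaledSep` at `SU(2)`).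

WHAT THIS FILE ADDS (kernel; [folklore] bookkeeping over n07-e's theorems, CITED by name — nothing of n07-e's is re-proved; nothing of Bałaban's is
asserted or refuted).
§1 (c3) `emb_mem_cubeEnl_zero_iff` — `Γ₁^{(1)} = {0}` for the one-cube index (n07-e's `blockOf_eq_zero_of_mem_cubeEnl` ∕ `emb_zero_mem_cubeEnl` + `Site.blockOf_emb`);
`mem_bondsOf_genSet_one` ∕ `not_mem_bondsOf_genSet_one` — which coarse bonds the scale-1 member `Γ₁` of the determining set pins.
§2 (c2) ★ THE REPAIR CERTIFICATE.  For n07-e's refuting datum (`Ω 1 = cubeEnl P L 0 0`, `W 0 = 1`, `W 1 = (1)^λ`, `λ = update 1 (e_{μ₀}) g`): PRINT's (7)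
plaquette at `p′ = (0; μ₀, μ₁)` — `W 1` on the two bonds meeting `Γ₁`, the AVERAGED scale-0 datum `M(W 0) = M(1) = 1` on the two bonds off `Γ₁`, i.e. the
holonomy of `spliceAt (genSet Ω 1 1) (W 1) ((avOfRecord F N K 0).avg (W 0))` (tree `B15DeterminingSets.spliceAt` = print's `V`∕`V̄` rule; node00-def-P11's
forthcoming `Sect2.mixedField` is this very term by dag-lead DEDUP-257 (A)) — EQUALS `g⁻¹` (`printedPlaq_mixedDatum_eq`), so `dist1 = dist1 g`
(`dist1_printedPlaq_mixedDatum`) and print's clause FAILS at every threshold `δ ≤ dist1 g` (`not_printed7_mixedDatum`); ★ `mixedDatum_typed_and_not_printed`: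
the SAME datum passes the TYPED clause at every `δ > 0` and fails the PRINTED one at every `δ ≤ dist1 g` — the re-typed fact (C′: datum clause
`PlaqSmallOn (plaqsOf (genSet s.Ω k n)) (δ n) (spliceAt (genSet s.Ω k n) (W n) ((avOfRecord F N K (n−1)).avg (W (n−1))))` for `1 ≤ n ≤ k`, def-P11's pen
`Sect2.DataSmall7` ∕ `VariationalThm1RegSepMixed`, INTENT-8 I.17052) MISSES the witness: CLASS refuted-MISSTATED, repair located, nothing printed refuted.
§3 (c4) `spliceAt_self`, ★ `spliceAt_avgFamily_succ` — for data IN THE IMAGE of the averaging (`W = M_𝐁(U′)`, [III] (2.10)–(2.12) p. 256: «V = V_j on Γ_j»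
with `V_j = M^j(U′)`) print's mixed field at scale `n+1` IS `M^{n+1}(U′)`: C′ reduces to the same-scale clause there (= [B7] Prop. 2, proved in the tree as
`BlockAveragingEMLProp2` ∕ `…N21LocalAveragedRegularity*`), i.e. the repair charges only the junk freedom, not the data of record.
§4 (c1) ★ `exists_su_dist1_eq (hN : 2 ≤ N) (0 ≤ t ≤ 2) : ∃ g : SU N, dist1 g = t` (from part 4's `exists_su_conj_norm_sub_one_ge`, p491268 — discharges n07-e's `hG`
on every `SU(N)`, `N ≥ 2`, and subsumes `su2_dist1_surj`); ★★ `not_variationalThm1ScaledSep_of_two_le (hN : 2 ≤ N) (ha₀) (ha₁) (B₃) : ¬ VariationalThm1ScaledSep F N B₃ a₀ a₁`,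
★★ `not_variationalThm1Class_of_two_le`, `variationalThm1ScaledSep_degenerate_of_two_le`, `variationalThm1Class_degenerate_of_two_le` (DISTINCT names — two
short-name homonyms `not_variationalThm1ScaledSep` already exist: n07-e's at `SU(2)`, and the `…Scaled` one of p498335; consumers qualify).
CONSEQUENCES (numbers, for the K0 lane): every theorem keyed on `VariationalThm1ScaledSep F N …` ∕ `VariationalThm1Class F N …` with `0 < a₀`, `0 < a₁` has an
UNINHABITED hypothesis for EVERY `N ≥ 2` (node00-def-K0a 11a∕11b∕11c, def-P11 FILE 5 v1.2 ∕ 7b ∕ 7c, the floors of p498335∕p499903, n07-e 17a∕17b) — not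
only at `SU(2)`.  HONEST FRAMING: K0⁗ (stmt-QuantumFields-20289) neither discharged nor refuted (`Provisos₁₃Sep.bg` is another token — def-P11
LOCATED-P11-MIXED-SUPPORT I.17052 says it is plausibly uninhabited too; no certificate here); counts unmoved (typed 28∕28 · discharged 5∕28); one finite `𝕋⁴`
family; not continuum ∕ OS ∕ mass gap ∕ Clay.  No `sorry`, `def`, `instance`, `notation`; standard axioms.  An independent general-`N` kernel route to the same
`¬`-facts through ym3's GLOBAL crude Prop 1 `BlockAveragingPlaquetteBound.dist1_plaqHol_avgFun_lt` (jump `h := g·M(1)⟨e_μ,ν⟩·M(1)⟨e_ν,μ⟩⁻¹`, no `avgFun_one`)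
is kept UNFILED as the seat's HOME twin `lean/BalabanUVNodesK0VariationalThm1DatumCoupling.v0-unfiled.lean` (397 l., farm rc 0, std axioms) per DEDUP-256 (A).
DEPENDENCES (CITED by name): n07-e `N07Thm1MixedPlaquetteObstruction.{blockOf_eq_zero_of_mem_cubeEnl, emb_zero_mem_cubeEnl, shift_shift_ne_self,
dist1_plaqHol_gaugeAct_one, gaugeAct_update_apply_self, gaugeAct_update_apply_other, not_variationalThm1ScaledSep_of_dist1, not_variationalThm1Class_of_dist1}`;
def-P11 `VariationalThm1ScaledSep ∕ VariationalThm1Class`; def-R `cubeEnl ∕ avOfRecord_avg`; `B15DeterminingSets.{genSet, gammaRegion_self, pts, mem_pts, bondsOf,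
avgFamily, spliceAt}`; `T3DescentFibreTower.avgFun_one ∕ expMeanLogSU_E_one`; `T4WilsonLinkAffine.shift_ne_self`; `Site.blockOf_emb`; part 1
`K0VariationalThm1ScaledCorner.lt_sitesPerDir_zero` (p498335); part 4 `K0BgProvisoOverRange.exists_su_conj_norm_sub_one_ge` (p491268).
-/


noncomputable section

open scoped Matrix.Norms.L2Operator

namespace Summit.QuantumFields.YangMills.Theorems.K0VariationalThm1DatumCoupling

open Literature.MathematicalPhysics.QuantumFieldTheory.Balaban1983to89
open Literature.MathematicalPhysics.QuantumFieldTheory.Balaban1983to89.Node00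
open Literature.MathematicalPhysics.QuantumFieldTheory.Balaban1983to89.T4Continuum
open B15DeterminingSets BlockAveraging ExpMeanLog
open Summit.QuantumFields.YangMills.BalabanUVNodes.N07Thm1MixedPlaquetteObstruction (blockOf_eq_zero_of_mem_cubeEnl emb_zero_mem_cubeEnl
  shift_shift_ne_self dist1_plaqHol_gaugeAct_one gaugeAct_update_apply_self gaugeAct_update_apply_other not_variationalThm1ScaledSep_of_dist1
  not_variationalThm1Class_of_dist1)
open Summit.QuantumFields.YangMills.Theorems.K0BgProvisoOverRange (exists_su_conj_norm_sub_one_ge)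

/-! ## §1  (c3) `Γ₁^{(1)} = {0}` for the one-cube index; the coarse bonds the scale-1 member of the determining set pins -/
section Geometry

variable {P : Params}

/-- **`Γ₁^{(1)} = {0}`**: a coarse site's centre lies in the cube `cubeEnl P L 0 0 = B(0)` iff the site is `0` (standing range `1 ≤ m + K`; no wrapping
`L < 2L^{m+K}`). [cite: Balaban1987RG1, (0.1)–(0.3) p.252; Balaban1988Convergent, (2.2) p.255 (bookkeeping)] -/
theorem emb_mem_cubeEnl_zero_iff (hj : 0 + 1 ≤ P.m + P.K) (hLn : P.L < P.sitesPerDir 0) (y : Site P 1) :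
    emb y ∈ cubeEnl P P.L 0 0 ↔ y = 0 := by
  refine ⟨fun h => ?_, fun h => h ▸ emb_zero_mem_cubeEnl⟩
  have h0 := blockOf_eq_zero_of_mem_cubeEnl hLn h
  rwa [Site.blockOf_emb hj] at h0

/-- A coarse bond issuing from the origin meets `Γ₁ = Ω₁^{(1)}` when `Ω₁` is the origin's block (`k = 1`). [cite: Balaban1988Convergent, (2.2) p.255, (2.10) p.256 (bookkeeping)] -/
theorem mem_bondsOf_genSet_one {Ω : ℕ → Set (Site P 0)} (hΩ : Ω 1 = cubeEnl P P.L 0 0) (μ : Fin P.d) :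
    (⟨0, μ⟩ : PBond P 1) ∈ bondsOf (genSet Ω 1 1) := by
  left
  show (0 : Site P 1) ∈ pts 1 (gammaRegion Ω 1 1)
  rw [gammaRegion_self, mem_pts, hΩ]
  exact emb_zero_mem_cubeEnl

/-- A coarse bond with BOTH ends off the origin does NOT meet `Γ₁ = Ω₁^{(1)} = {0}`: the scale-1 member of the determining set does not pin it — print's (7)
reads the AVERAGED finer datum `V̄` there. [cite: Balaban1985Variational, (7) p.278; Balaban1988Convergent, (2.2) p.255 (bookkeeping)] -/
theorem not_mem_bondsOf_genSet_one (hj : 0 + 1 ≤ P.m + P.K) (hLn : P.L < P.sitesPerDir 0) {Ω : ℕ → Set (Site P 0)}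
    (hΩ : Ω 1 = cubeEnl P P.L 0 0) (c : PBond P 1) (hs : c.src ≠ 0) (ht : c.tgt ≠ 0) : c ∉ bondsOf (genSet Ω 1 1) := by
  have hΓ : ∀ y : Site P 1, y ∈ pts 1 (gammaRegion Ω 1 1) → y = 0 := fun y hy => by
    rw [gammaRegion_self, mem_pts, hΩ] at hy
    exact (emb_mem_cubeEnl_zero_iff hj hLn y).1 hy
  rintro (hc | hc)
  · exact hs (hΓ _ hc)
  · exact ht (hΓ _ hc)

end Geometry

/-! ## §2  (c2) ★ The repair certificate: print's (7) plaquette of the refuting datum is the jump itself -/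
section Printed

variable {F : T4Family} {N : ℕ} [NeZero N]

/-- **PRINT'S (7) PLAQUETTE OF THE MIXED DATUM IS `g⁻¹`.**  On the torus `F.P K` with `Ω 1 = cubeEnl P L 0 0`, for the datum `W 0 = 1`, `W 1 = (1)^λ`,
`λ = update 1 (e_{μ₀}) g`: the holonomy around `p′ = (0; μ₀, μ₁)` of print's field — `W 1` on the bonds meeting `Γ₁` (`⟨0,μ₀⟩ ↦ g⁻¹`, `⟨0,μ₁⟩ ↦ 1`), the
averaged scale-0 datum `M(1) = 1` on the two bonds off `Γ₁` — is `g⁻¹`. [cite: Balaban1985Variational, (7) p.278; Balaban1987RG1, (0.4) p.253 (bookkeeping)] -/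
theorem printedPlaq_mixedDatum_eq {K : ℕ} {Ω : ℕ → Set (Site (F.P K) 0)} (hΩ : Ω 1 = cubeEnl (F.P K) (F.P K).L 0 0)
    {μ0 μ1 : Fin (F.P K).d} (hμ : μ0 < μ1) (g : SU N) {W : MSField (F.P K) (SU N)} (hW0 : W 0 = 1)
    (hW1 : W 1 = GaugeField.gaugeAct (Function.update (fun _ : Site (F.P K) 1 => (1 : SU N)) ((0 : Site (F.P K) 1).shift μ0) g) 1) :
    GaugeField.plaqHol (spliceAt (genSet Ω 1 1) (W 1) ((avOfRecord F N K 0).avg (W 0))) ⟨0, μ0, μ1, hμ⟩ = g⁻¹ := by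
  classical
  have hj : 0 + 1 ≤ (F.P K).m + (F.P K).K := by have := F.hm; simp only [T4Family.P_m, T4Family.P_K]; omega
  have hLn : (F.P K).L < (F.P K).sitesPerDir 0 := K0VariationalThm1ScaledCorner.lt_sitesPerDir_zero F K
  have hne : μ0 ≠ μ1 := ne_of_lt hμ
  -- print's `V̄`: the averaged scale-0 datum is `1` everywhere
  have hV : (avOfRecord F N K 0).avg (W 0) = 1 := by
    rw [avOfRecord_avg, hW0, T3DescentFibreTower.avgFun_one _ T3DescentFibreTower.expMeanLogSU_E_one]
  -- the four bonds of `p′`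
  have e1 : spliceAt (genSet Ω 1 1) (W 1) ((avOfRecord F N K 0).avg (W 0)) ⟨0, μ0⟩ = g⁻¹ := by
    simp only [spliceAt, if_pos (mem_bondsOf_genSet_one hΩ μ0), hW1, gaugeAct_update_apply_self]
  have e4 : spliceAt (genSet Ω 1 1) (W 1) ((avOfRecord F N K 0).avg (W 0)) ⟨0, μ1⟩ = 1 := by
    simp only [spliceAt, if_pos (mem_bondsOf_genSet_one hΩ μ1), hW1, gaugeAct_update_apply_other 0 hne g]
  have e2 : spliceAt (genSet Ω 1 1) (W 1) ((avOfRecord F N K 0).avg (W 0)) ⟨(0 : Site (F.P K) 1).shift μ0, μ1⟩ = 1 := by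
    simp only [spliceAt, if_neg (not_mem_bondsOf_genSet_one hj hLn hΩ ⟨(0 : Site (F.P K) 1).shift μ0, μ1⟩ (T4WilsonLinkAffine.shift_ne_self 0 μ0)
      (shift_shift_ne_self hne)), hV]
    rfl
  have e3 : spliceAt (genSet Ω 1 1) (W 1) ((avOfRecord F N K 0).avg (W 0)) ⟨(0 : Site (F.P K) 1).shift μ1, μ0⟩ = 1 := by
    simp only [spliceAt, if_neg (not_mem_bondsOf_genSet_one hj hLn hΩ ⟨(0 : Site (F.P K) 1).shift μ1, μ0⟩ (T4WilsonLinkAffine.shift_ne_self 0 μ1)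
      (shift_shift_ne_self hne.symm)), hV]
    rfl
  show spliceAt (genSet Ω 1 1) (W 1) ((avOfRecord F N K 0).avg (W 0)) ⟨0, μ0⟩ *
      spliceAt (genSet Ω 1 1) (W 1) ((avOfRecord F N K 0).avg (W 0)) ⟨(0 : Site (F.P K) 1).shift μ0, μ1⟩ *
      (spliceAt (genSet Ω 1 1) (W 1) ((avOfRecord F N K 0).avg (W 0)) ⟨(0 : Site (F.P K) 1).shift μ1, μ0⟩)⁻¹ *
      (spliceAt (genSet Ω 1 1) (W 1) ((avOfRecord F N K 0).avg (W 0)) ⟨0, μ1⟩)⁻¹ = g⁻¹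
  rw [e1, e2, e3, e4, inv_one, mul_one, mul_one, mul_one]

/-- `dist1` of print's (7) plaquette of the mixed datum is `dist1 g` — the size of the jump. [cite: Balaban1985Variational, (7) p.278 (bookkeeping)] -/
theorem dist1_printedPlaq_mixedDatum {K : ℕ} {Ω : ℕ → Set (Site (F.P K) 0)} (hΩ : Ω 1 = cubeEnl (F.P K) (F.P K).L 0 0)
    {μ0 μ1 : Fin (F.P K).d} (hμ : μ0 < μ1) (g : SU N) {W : MSField (F.P K) (SU N)} (hW0 : W 0 = 1)
    (hW1 : W 1 = GaugeField.gaugeAct (Function.update (fun _ : Site (F.P K) 1 => (1 : SU N)) ((0 : Site (F.P K) 1).shift μ0) g) 1) :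
    dist1 (GaugeField.plaqHol (spliceAt (genSet Ω 1 1) (W 1) ((avOfRecord F N K 0).avg (W 0))) ⟨0, μ0, μ1, hμ⟩) = dist1 g := by
  rw [printedPlaq_mixedDatum_eq hΩ hμ g hW0 hW1, GaugeGroup.dist1_inv]

/-- **★ PRINT'S (7) FAILS AT THE WITNESS** at every threshold `δ ≤ dist1 g`: the mixed datum is NOT `δ`-small in the printed (`V`∕`V̄`) sense on the plaquettes
touching `Γ₁` — the re-typed datum clause C′ excludes it. [cite: Balaban1985Variational, (7) p.278 (bookkeeping)] -/
theorem not_printed7_mixedDatum {K : ℕ} {Ω : ℕ → Set (Site (F.P K) 0)} (hΩ : Ω 1 = cubeEnl (F.P K) (F.P K).L 0 0)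
    {μ0 μ1 : Fin (F.P K).d} (hμ : μ0 < μ1) (g : SU N) {W : MSField (F.P K) (SU N)} (hW0 : W 0 = 1)
    (hW1 : W 1 = GaugeField.gaugeAct (Function.update (fun _ : Site (F.P K) 1 => (1 : SU N)) ((0 : Site (F.P K) 1).shift μ0) g) 1)
    {δ : ℝ} (hδ : δ ≤ dist1 g) :
    ¬ PlaqSmallOn (B8Eq17ClassAkV1.plaqsOf (genSet Ω 1 1)) δ (spliceAt (genSet Ω 1 1) (W 1) ((avOfRecord F N K 0).avg (W 0))) := by
  intro h
  have hp : (⟨0, μ0, μ1, hμ⟩ : Plaq (F.P K) 1) ∈ B8Eq17ClassAkV1.plaqsOf (genSet Ω 1 1) := by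
    rw [B8Eq17ClassAkV1.mem_plaqsOf]
    left
    show (0 : Site (F.P K) 1) ∈ pts 1 (gammaRegion Ω 1 1)
    rw [gammaRegion_self, mem_pts, hΩ]
    exact emb_zero_mem_cubeEnl
  have hlt := h _ hp
  rw [dist1_printedPlaq_mixedDatum hΩ hμ g hW0 hW1] at hlt
  exact absurd hlt (not_lt.2 hδ)

/-- **★ THE WITNESS PASSES THE TYPED CLAUSE AND FAILS THE PRINTED ONE** — the located misstatement in one line: at the mixed datum (any `g`), the tree's
same-scale clause `PlaqSmallOn (plaqsOf (genSet s.Ω 1 n)) δ (W n)` holds for EVERY `δ > 0` at both scales (pure gauges are flat), while print's (7) clause —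
the same with the scale-1 field replaced by `spliceAt (genSet s.Ω 1 1) (W 1) ((avOfRecord F N K 0).avg (W 0))` — fails for every `δ ≤ dist1 g`.  CLASS:
refuted-MISSTATED; the repaired statement (C′, node00-def-P11's `Sect2.DataSmall7`-guarded fact) misses the witness. [cite: Balaban1985Variational, (7) p.278;
Balaban1988Convergent, (2.10)–(2.12) p.256 (bookkeeping)] -/
theorem mixedDatum_typed_and_not_printed {K : ℕ} {Ω : ℕ → Set (Site (F.P K) 0)} (hΩ : Ω 1 = cubeEnl (F.P K) (F.P K).L 0 0)
    {μ0 μ1 : Fin (F.P K).d} (hμ : μ0 < μ1) (g : SU N) {W : MSField (F.P K) (SU N)} (hW0 : W 0 = 1)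
    (hW1 : W 1 = GaugeField.gaugeAct (Function.update (fun _ : Site (F.P K) 1 => (1 : SU N)) ((0 : Site (F.P K) 1).shift μ0) g) 1) :
    (∀ δ : ℝ, 0 < δ → ∀ n, n ≤ 1 → PlaqSmallOn (B8Eq17ClassAkV1.plaqsOf (genSet Ω 1 n)) δ (W n)) ∧
    (∀ δ : ℝ, δ ≤ dist1 g → ¬ PlaqSmallOn (B8Eq17ClassAkV1.plaqsOf (genSet Ω 1 1)) δ
        (spliceAt (genSet Ω 1 1) (W 1) ((avOfRecord F N K 0).avg (W 0)))) := by
  refine ⟨fun δ hδ n hn q _ => ?_, fun δ hδ => not_printed7_mixedDatum hΩ hμ g hW0 hW1 hδ⟩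
  rcases Nat.le_one_iff_eq_zero_or_eq_one.mp hn with rfl | rfl
  · rw [hW0]
    show dist1 ((1 : SU N) * 1 * (1 : SU N)⁻¹ * (1 : SU N)⁻¹) < δ
    rw [inv_one, mul_one, mul_one, mul_one, GaugeGroup.dist1_one]; exact hδ
  · rw [hW1, dist1_plaqHol_gaugeAct_one]; exact hδ

end Printed

/-! ## §3  (c4) Print's mixed field of an AVERAGED family is the averaged family: C′ charges only the junk freedom -/
section Image

variable {P : Params} {G : Type*}

/-- Splicing a field with itself changes nothing. [cite: Balaban1989LargeFieldI, (1.20) p.180 (bookkeeping)] -/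
theorem spliceAt_self {j : ℕ} (S : Set (Site P j)) (V : GaugeField P j G) : spliceAt S V V = V := by
  funext b; unfold spliceAt; split_ifs <;> rfl

variable [GaugeGroup G]

/-- **C′ IS FREE FOR DATA OF RECORD**: for a datum in the image of the multi-scale averaging, `W = M_𝐁(U′)` (`avgFamily av U′`, [III] (2.10)–(2.11): `V = M^j(U′)`
on `Γ_j`), print's scale-`(n+1)` mixed field — `W (n+1)` on the bonds meeting `S`, the one-step average of `W n` elsewhere — IS `W (n+1) = M^{n+1}(U′)`
(`M^{n+1} = M ∘ M^n`): on such data print's (7) is the same-scale clause, i.e. [Balaban1985Averaging] Prop. 2 territory. [cite: Balaban1988Convergent, (2.10)–(2.11) p.256;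
Balaban1985Variational, (7) p.278 (bookkeeping)] -/
theorem spliceAt_avgFamily_succ (av : ∀ j, Averaging P j G) (U : GaugeField P 0 G) (n : ℕ) (S : Set (Site P (n + 1))) :
    spliceAt S (avgFamily av U (n + 1)) ((av n).avg (avgFamily av U n)) = avgFamily av U (n + 1) :=
  spliceAt_self S _

end Image

/-! ## §4  (c1) Every `SU(N)`, `N ≥ 2` -/
section GeneralN

variable {F : T4Family} {N : ℕ} [NeZero N]

/-- **`SU(N)`, `N ≥ 2`, has an element at every distance `t ∈ [0, 2]` from the identity** (part 4's diagonal phase witness `exists_su_conj_norm_sub_one_ge`: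
`dist1 D ≤ t` and `t ≤ ‖w·D·w⁻¹ − 1‖` for every unit `w`, at `w = 1`) — discharges n07-e's `hG` on every `SU(N)` and subsumes `su2_dist1_surj`. [folklore] -/
theorem exists_su_dist1_eq (hN : 2 ≤ N) {t : ℝ} (h0 : 0 ≤ t) (h2 : t ≤ 2) : ∃ g : SU N, dist1 g = t := by
  obtain ⟨g, hle, hge⟩ := exists_su_conj_norm_sub_one_ge (N := N) hN h0 h2
  refine ⟨g, le_antisymm hle ?_⟩
  have h := hge 1
  simp only [Units.val_one, inv_one, one_mul, mul_one] at h
  exact h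

/-- **★★ `¬ VariationalThm1ScaledSep F N B₃ a₀ a₁` FOR EVERY `B₃` ON EVERY `SU(N)`, `N ≥ 2`** (`0 < a₀`, `0 < a₁`): n07-e's `…_of_dist1` at the general-`N` group
witness. [cite: Balaban1985Variational, Thm 1 (7)–(8) pp.278–279; Balaban1988Convergent, (2.10)–(2.12) p.256 (bookkeeping)] -/
theorem not_variationalThm1ScaledSep_of_two_le (hN : 2 ≤ N) {a₀ a₁ : ℝ} (ha₀ : 0 < a₀) (ha₁ : 0 < a₁) (B₃ : ℝ) :
    ¬ VariationalThm1ScaledSep F N B₃ a₀ a₁ :=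
  not_variationalThm1ScaledSep_of_dist1 F (exists_su_dist1_eq hN zero_le_one one_le_two) ha₀ ha₁

/-- **★★ `¬ VariationalThm1Class F N B₃ a₀ a₁` FOR EVERY `B₃` ON EVERY `SU(N)`, `N ≥ 2`** (`0 < a₀`, `0 < a₁`). [cite: Balaban1985Variational, Thm 1 (7)–(8) pp.278–279 (bookkeeping)] -/
theorem not_variationalThm1Class_of_two_le (hN : 2 ≤ N) {a₀ a₁ : ℝ} (ha₀ : 0 < a₀) (ha₁ : 0 < a₁) (B₃ : ℝ) :
    ¬ VariationalThm1Class F N B₃ a₀ a₁ :=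
  not_variationalThm1Class_of_dist1 F (exists_su_dist1_eq hN zero_le_one one_le_two) ha₀ ha₁

/-- The faithful per-scale fact holds on `SU(N)`, `N ≥ 2`, ONLY at degenerate constants (`a₀ ≤ 0` or `a₁ ≤ 0`) — never where a consumer's numerics
`0 < cR·ε_n ≤ a₁`, `B₃·cR·ε_n ≤ εreg ≤ a₀` can be met. [cite: Balaban1985Variational, Thm 1 (7)–(8) p.279 (bookkeeping)] -/
theorem variationalThm1ScaledSep_degenerate_of_two_le (hN : 2 ≤ N) {B₃ a₀ a₁ : ℝ} (h : VariationalThm1ScaledSep F N B₃ a₀ a₁) :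
    a₀ ≤ 0 ∨ a₁ ≤ 0 := by
  by_contra hc; rw [not_or, not_le, not_le] at hc; exact not_variationalThm1ScaledSep_of_two_le hN hc.1 hc.2 B₃ h

/-- The printed-uniform fact, AS TYPED, holds on `SU(N)`, `N ≥ 2`, ONLY at degenerate constants (`a₀ ≤ 0` or `a₁ ≤ 0`). [cite: Balaban1985Variational, Thm 1 (7)–(8) p.279 (bookkeeping)] -/
theorem variationalThm1Class_degenerate_of_two_le (hN : 2 ≤ N) {B₃ a₀ a₁ : ℝ} (h : VariationalThm1Class F N B₃ a₀ a₁) : a₀ ≤ 0 ∨ a₁ ≤ 0 := by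
  by_contra hc; rw [not_or, not_le, not_le] at hc; exact not_variationalThm1Class_of_two_le hN hc.1 hc.2 B₃ h

end GeneralN

end Summit.QuantumFields.YangMills.Theorems.K0VariationalThm1DatumCoupling

end
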